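import Summits.QuantumFields.BalabanUV.Beta.RowD1JointEndSymReflTablesAn1S2M
import Summits.QuantumFields.BalabanUV.Beta.SecondOrderSplitLoc
import Summits.QuantumFields.BalabanUV.Beta.DshAn1Spread
import Summits.QuantumFields.BalabanUV.Beta.RecursiveStencilSlot

/-!
# `BalabanUV.Beta.SymDressedResponseLoc` — binder row D1, hR side of the (0.4) ROOT: **THE LOCALISATION (hDg) OF THE DRESSED FIRST-ORDER RESPONSE WORD
# OF THE LITERAL ROOT IS A THEOREM** — `Loc (dM G_j Lc (fun κ u ↦ Sp_j κ u + conjV 𝕄_j (diagK (γ_j·E_{κu}))) (M1Of 3 Lc (symHessFFAt ρ_c Lc) cΛ j) ν y′)`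
# for the (0.4)-symmetrised letters (`G_j = Gsym Lc j`, `𝕄_j = bhKStepSh 3 Lc (Dsh Lc) j`, `Sp_j = SpureRecOf … j` over an1's sym tables, `E = ctGenM 3 (bhK+Dsh)`)
# — the sym twin of leaf-10's `SecondOrderSplitLiteral.loc_dM_sharp_literal`, by leaf-10's generic `SecondOrderSplitLoc.loc_dM_sharp` at one common rate
# (β sub-cell, BINDER-OWNERS row D1 OWNER `b2b-balaban-beta-an2`, gen 32; brick (N12a))

HONEST FRAMING (cell charter, verbatim): «discharging BetaPertH makes Balaban's UV stability UNCONDITIONAL — a real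
constructive-QFT result; it is NOT the continuum limit and NOT the Clay problem.»
HONEST DEPENDENCY: continuum YM on T⁴ ⇐ BetaPertH ∧ nine spine estimates (0/9 proved); BetaPertH ⇐ (D1) ∧ (D4) ∧ CAP+tail;
G-an2-4 gates asym, D1 and NE2/3/4.
DERIVED cell leaf ([folklore] decay ∕ localisation bookkeeping over OUR objects, every estimate BY NAME: `SymmetrisedStepJets.decays_Gsym`,
`SymShiftedSpread.spr_bhKStepSh`, `DshAn1.spr_Dsh`, `SpineRooted.locStencil_SpureRecOf`, `SymAveragingHessianCounts.vertexFamily_symHessFFAt`,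
`E3ContactGenerator.locStencil_diagK_ctGenM`, `SecondOrderSplitLoc.loc_dM_sharp`).  No statement of Bałaban's papers, no `[cite:]`, no `Prop` fact, no `def`.
Discharges the binder `hDg` of ROOT K `RowD1JointEndSymReflTablesAn1S2R` (packaged in ROOT L `RowD1JointEndSymReflTablesAn1S2RD`); NOT D1, NOT BetaPertH,
NOT continuum, NOT Clay.

* §1 **`sym_literal_common`**: ONE common rate `m > 0` at which `G_j` and `𝕄_j` decay, `Sp_j` is a local stencil family and the generator family
  `κ u ↦ diagK (E_{κu})` is a local stencil family (rates shrunk to the minimum).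
* §2 **`hDg_sym`** — the binder `hDg` of ROOTs G–K VERBATIM, every `cΛ`, `γ`, `j`, `α`, `ν`, `y′`.
Provenance: β sub-cell, unit beta-an2 gen 32, 2026-08-21 (v1); no existing file touched.
-/

noncomputable section

open Finset
open scoped BigOperators
open Literature.MathematicalPhysics.QuantumFieldTheory
open Literature.MathematicalPhysics.QuantumFieldTheory.Balaban1983to89
open Literature.MathematicalPhysics.QuantumFieldTheory.Balaban1983to89.Beta
open ExpKernelCalculus (MKer Decays BiLoc VertexFamily)
open AffineAveraging (box toSite)
open AveragingContoursRooted (ctr ctrOff ctrOff_mem_box)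
open OneStepResolventKernel (Fib LocStencil decays_mono)
open OneStepKernelFamily (KInvStep)
open BalabanStepJets (locStencil_mono)
open StepJetData (locStencil_smul)
open SecondOrderResponse (dM)
open Summit.QuantumFields.BalabanUV.Beta.TameKernelCalculus
open Summit.QuantumFields.BalabanUV.Beta.ChartConjugation (conjV)
open Summit.QuantumFields.BalabanUV.Beta.AxialDressingRooted (one_le_of_neZero)
open Summit.QuantumFields.BalabanUV.Beta.SymmetrisedStepJets (Gsym decays_Gsym)
open Summit.QuantumFields.BalabanUV.Beta.SpineRooted (M1Of SpureRecOf vertexFamily_M1Of locStencil_SpureRecOf)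
open Summit.QuantumFields.BalabanUV.Beta.SymShiftedSpread (bhKStepSh bhKStepSh_zero spr_bhKStepSh)
open Summit.QuantumFields.BalabanUV.Beta.BorderedHessian (bhK diagK)
open Summit.QuantumFields.BalabanUV.Beta.E3ContactGenerator (ctGenM locStencil_diagK_ctGenM)
open Summit.QuantumFields.BalabanUV.Beta.DshAn1 (Dsh spr_Dsh)
open Summit.QuantumFields.BalabanUV.Beta.VertexReflectionContact (smul_diagK)
open Summit.QuantumFields.BalabanUV.Beta.SymAveragingHessianCounts (symVhSAt symHessFFAt symVhSAt_hV_ctr symHessFFAt_hH_ctr vertexFamily_symHessFFAt)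
open Summit.QuantumFields.BalabanUV.Beta.SecondOrderSplitLoc (loc_dM_sharp)

namespace Summit.QuantumFields.BalabanUV.Beta.SymDressedResponseLoc

variable {Lc : ℕ} [NeZero Lc]

/-! ## §1 One common rate for the (0.4) letters at level `j` -/

/-- [folklore] **COMMON RATE**: at some `m > 0`, `Gsym Lc j` decays (constant `C ≥ 0`), `bhKStepSh 3 Lc (Dsh Lc) j` decays, the pure first-order
jet `SpureRecOf … j` over an1's sym tables is a local stencil family, and the generator family `κ u ↦ diagK (ctGenM 3 (bhK+Dsh) α Lc κ u)` is a
local stencil family. -/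
theorem sym_literal_common (cΛ : ℝ) (j : ℕ) (α : Fin 4) :
    ∃ m C C𝕄 Cs Cg : ℝ, 0 < m ∧ 0 ≤ C ∧ Decays (Gsym (d := 3) Lc j) C m ∧ Decays (bhKStepSh 3 Lc (Dsh Lc) j) C𝕄 m ∧
      LocStencil (SpureRecOf 3 Lc (symVhSAt (ctr 4 Lc) 3 Lc rfl) (symHessFFAt (ctr 4 Lc) Lc) (Gsym Lc) ((Lc : ℝ) ^ 4) (-((Lc : ℝ) ^ 8 / 2)) cΛ j) Cs m ∧
      LocStencil (fun κ u => diagK (ctGenM 3 (bhK Lc + Dsh Lc) α Lc κ u)) Cg m := by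
  have hLc1 : 1 ≤ Lc := one_le_of_neZero Lc
  obtain ⟨δG, CG, hδG, hCG, hG⟩ := decays_Gsym (d := 3) Lc j
  obtain ⟨C𝕄, δ𝕄, hδ𝕄, h𝕄⟩ := spr_bhKStepSh (d := 3) (Lc := Lc) (spr_Dsh (d := 3) hLc1) j
  obtain ⟨Cs, δs, hδs, hS⟩ := locStencil_SpureRecOf (d := 3) hLc1 (symVhSAt_hV_ctr (d := 3) hLc1) (symHessFFAt_hH_ctr (d := 3) hLc1)
    (decays_Gsym (d := 3) Lc) ((Lc : ℝ) ^ 4) (-((Lc : ℝ) ^ 8 / 2)) cΛ j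
  obtain ⟨CB, δB, hδB, hB⟩ := spr_bhKStepSh (d := 3) (Lc := Lc) (spr_Dsh (d := 3) hLc1) 0
  rw [bhKStepSh_zero] at hB
  have hgen := locStencil_diagK_ctGenM (d := 3) (α := α) (L := Lc) hB hδB.le
  set m := min (min (min δG δ𝕄) δs) (δB / 2) with hm_def
  have hm : 0 < m := lt_min (lt_min (lt_min hδG hδ𝕄) hδs) (half_pos hδB)
  have h1 : m ≤ δG := (min_le_left _ _).trans ((min_le_left _ _).trans (min_le_left _ _))
  have h2 : m ≤ δ𝕄 := (min_le_left _ _).trans ((min_le_left _ _).trans (min_le_right _ _))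
  have h3 : m ≤ δs := (min_le_left _ _).trans (min_le_right _ _)
  have h4 : m ≤ δB / 2 := min_le_right _ _
  exact ⟨m, CG, |C𝕄|, |Cs|, |1 + ((Lc : ℝ) ^ (3 + 1))⁻¹ * CB|, hm, hCG, decays_mono hG hCG le_rfl h1, decays_of_le h𝕄 h2,
    fun κ u => biLoc_of_le (hS κ u) h3, fun κ u => biLoc_of_le (hgen κ u) h4⟩

/-! ## §2 (hDg) for the literal root -/

/-- [folklore] **THE BINDER `hDg` OF THE LITERAL ROOT — A THEOREM**: the dressed first-order response word
`dM G_j Lc (κ u ↦ Sp_j κ u + conjV 𝕄_j (diagK (γ_j·E_{κu}))) (M1Of 3 Lc (symHessFFAt ρ_c Lc) cΛ j) ν y′` is localised (leaf-10's `loc_dM_sharp` at the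
common rate of §1). -/
theorem hDg_sym (cΛ : ℝ) (γ : ℕ → ℝ) :
    ∀ (j : ℕ) (α ν : Fin 4) (y' : Fin 4 → ℤ),
      Loc (dM (Gsym (d := 3) Lc j) Lc (fun κ u => SpureRecOf 3 Lc (symVhSAt (ctr 4 Lc) 3 Lc rfl) (symHessFFAt (ctr 4 Lc) Lc) (Gsym Lc) ((Lc : ℝ) ^ 4)
        (-((Lc : ℝ) ^ 8 / 2)) cΛ j κ u + conjV (bhKStepSh 3 Lc (Dsh Lc) j) (diagK fun p c => γ j * ctGenM 3 (bhK Lc + Dsh Lc) α Lc κ u p c))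
        (M1Of 3 Lc (symHessFFAt (ctr 4 Lc) Lc) cΛ j) ν y') := by
  intro j α ν y'
  have hLc1 : 1 ≤ Lc := one_le_of_neZero Lc
  obtain ⟨m, C, C𝕄, Cs, Cg, hm, hC, hG, h𝕄, hS, hgen⟩ := sym_literal_common (Lc := Lc) cΛ j α
  have hgl : LocStencil (fun κ u => diagK fun p c => γ j * ctGenM 3 (bhK Lc + Dsh Lc) α Lc κ u p c) (|γ j| * Cg) m := by
    have h := locStencil_smul (γ j) hgen
    have e : (fun κ' u => γ j • diagK (ctGenM 3 (bhK Lc + Dsh Lc) α Lc κ' u)) =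
        fun κ u => diagK fun p c => γ j * ctGenM 3 (bhK Lc + Dsh Lc) α Lc κ u p c := by
      funext κ u; exact smul_diagK _ _
    rw [e] at h
    exact h
  have hM : VertexFamily (M1Of 3 Lc (symHessFFAt (ctr 4 Lc) Lc) cΛ j) Lc (|cΛ * BalabanStepW2.wM1 3 Lc j| * _) m :=
    vertexFamily_M1Of (vertexFamily_symHessFFAt (d := 3) hLc1 (ctrOff_mem_box hLc1) hm.le) cΛ j
  exact loc_dM_sharp (N := Lc) hG hC h𝕄 hm hS hM hgl ν y'

end Summit.QuantumFields.BalabanUV.Beta.SymDressedResponseLoc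

end
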